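import Summits.QuantumFields.BalabanUV.Beta.CapRowsVertexTori
import Summits.QuantumFields.BalabanUV.Beta.GAN24.BorderedFrameInverse
import Summits.QuantumFields.BalabanUV.Beta.CapacitanceSplit

/-!
# Beta / CapRouteA — row CAP-k: ROUTE A's NORM CHAIN IN THE KERNEL — the (Z2) certificate of the one-loop form from a resolvent-norm bound and
# stencil norms ON THE VERTEX TORI, `M_a = n_F·(B·S_st + B·S_s·B′·S_t)` (β sub-cell, BINDER-OWNERS row CAP-k item (b), lineage
# `b2b-balaban-beta-an5`, gen 21; node BETA-an5-g21-FACE-MAXMOD part 4)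

HONEST FRAMING (cell rule, page 1).  Discharging `BetaPertH` makes Bałaban's UV stability UNCONDITIONAL — a real constructive-QFT result; it is NOT
the continuum limit and NOT the Clay problem.  HONEST DEPENDENCY: continuum YM on T⁴ ⇐ BetaPertH ∧ nine spine estimates (0/9 proved); BetaPertH ⇐
(D1) ∧ (D4) ∧ CAP+tail; G-an2-4 gates asym, D1 and NE2/3/4.  KERNEL GLUE ONLY: nothing below instantiates a binder; no `κ, a, B, S, N, t, r` is
asserted; no certificate is consumed or produced; 0 certified coefficients.

WHAT.  CAP-KERNEL §4.10 (iii) («THE MASTER BOUND»): for `g(q) = tr[k₀(q)⁻¹ k_st(q)] − tr[k₀(q)⁻¹ k_s(q) k₀′(q)⁻¹ k_t(q)]`,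
`|g| ≤ n_F·(S_st·B_a + S_s·S_t·B_a·B_a′)` with `B_a ≥ ‖k₀⁻¹‖₂`, `B_a′ ≥ ‖k₀′⁻¹‖₂`, `S_κ ≥ ‖k_κ‖₂` (`|tr(XY)| ≤ n_F ‖X‖₂‖Y‖₂`), and for a stencil family
`k_κ(q) = Σ_R K_κ[R] e^{iq·R}` on the tube `|Im q_μ| ≤ w_μ`: `‖k_κ(q)‖₂ ≤ Σ_R ‖K_κ[R]‖₂ e^{Σ_μ |R_μ| w_μ}` (interface I-ζ5's weighted stencil sums).
By the distinguished-boundary maximum principle (`TubeMaximumModulus`, `CapRowsVertexTori`) every one of these bounds is needed ON THE VERTEX TORI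
ONLY.  This module makes the chain a kernel theorem in the Euclidean operator norm (Mathlib's scoped `Matrix.Norms.L2Operator`; entry and pairing
bounds from `GAN24.BorderedFrameInverse` §1):

* §1 `norm_trace_mul_le` (`|tr(XY)| ≤ |n|·‖X‖·‖Y‖`; the trace step is the tree's `QuantumLattice.norm_trace_le_card_mul_norm`, inlined), `norm_oneLoopForm_le_routeA` (the master bound, pointwise).
* §2 `norm_character_le_of_mem_tube` (`|e^{i x·q}| ≤ e^{Σ|x_μ| w_μ}` on the tube), `norm_characterSum_le_of_mem_tube` (the weighted stencil
  sum bounds a character-sum family on the tube — (Z2b) is a closed-form number given the stencil tables).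
* §3 the binder and the rows: `stripRegularC_oneLoopForm_routeA₂` (STRUCTURE `MatTubeHol` ×5 and (Z1) at the zero-free width `a`; on
  `VertexTori κ`, `κ ≤ a`: resolvent bounds `‖(A q)⁻¹‖ ≤ B`, `‖(A′ q)⁻¹‖ ≤ B′` — THE LOCATED ANALYTIC LEMMA ∕ an «A1-explicit» face certificate,
  CAP-KERNEL §4.16 — and stencil bounds `S_st, S_s, S_t` ⟹ `StripRegularC (t₁ − t₂) κ (|n|·(B·S_st + B·S_s·B′·S_t))`),
  `rowsOfOneLoopFormCode16E_routeA₂` + the certified-road END `betaAvgAFH_of_oneLoopFormCode16E_routeA₂` — row CAP-k's typed target with the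
  (Z2) binder REPLACED by (Z2a) two resolvent-norm numbers + (Z2b) three stencil numbers on the vertex tori; the tail budget takes
  `M := |n|·(B·S_st + B·S_s·B′·S_t)` (`CapLatticeBudget.budget_code16_param`).
* §4 THEOREM MP FOR MATRIX FAMILIES: `matTubeHol_opNorm_le_of_vertexTori` — `sup_{tube} ‖A(q)‖₂ = max_{vertex tori} ‖A(q)‖₂` (the scalar face
  theorem applied to `q ↦ xᴴ A(q) y`), so a face certificate of `‖k₀⁻¹‖₂` IS the strip constant `B_a` wherever a strip constant is wanted.

[folklore] throughout; 0 `sorry`; 0 cite tags.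
-/

namespace Summit.QuantumFields.BalabanUV.Beta.CapRouteA

open Complex Matrix WithLp
open Literature.MathematicalPhysics.QuantumFieldTheory.Balaban1983to89
open Literature.MathematicalPhysics.QuantumFieldTheory.Balaban1983to89.Beta
open FlowStep FlowStepRuns DagBinding
open B4Strip (Strip)
open B4ContourShift (latticeKernel)
open B4TorusKernel (descend gridPt)
open Beta.RemainderChain (RemainderConst)
open Beta.RateCertificate (GeomRate)
open Beta.AveragedAFCarrier (BetaAvgAFH)
open Beta.AliasingTailL1 (StripRegularC aliasRatioL1 PolyStrip)
open Beta.AliasingTailLattice (codeTheta code16SetE)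
open Summit.QuantumFields.BalabanUV.Beta.CapRows
open Summit.QuantumFields.BalabanUV.Beta.CapRowsLattice (rowsOfCode16E betaAvgAFH_of_anchorCode16E)
open Summit.QuantumFields.BalabanUV.Beta.PolyRegularAlgebra (character)
open Summit.QuantumFields.BalabanUV.Beta.TubeMaximumModulus
open Summit.QuantumFields.BalabanUV.Beta.CapRowsVertexTori (stripRegularC_oneLoopForm₂_ofVertexTori)
open Summit.QuantumFields.BalabanUV.Beta.GAN24.BorderedFrameInverse (norm_entry_le norm_dotProduct_mulVec_le
  star_dotProduct_mulVec_eq_inner)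
open scoped Real Matrix.Norms.L2Operator InnerProductSpace

noncomputable section

/-! ## §1 Trace and product bounds in the Euclidean operator norm -/

section Norms

variable {n : Type*} [Fintype n] [DecidableEq n]

/-- `|tr(X Y)| ≤ |n| · ‖X‖₂ · ‖Y‖₂` (CAP-KERNEL §4.10 (iii)); the trace step `|tr Z| ≤ |n|·‖Z‖₂` (every diagonal entry is bounded by the
operator norm) is the tree's `Literature.MathematicalPhysics.QuantumLattice.norm_trace_le_card_mul_norm`, re-derived inline from
`GAN24.BorderedFrameInverse.norm_entry_le` to keep this file's imports inside the β sub-cell. [folklore] -/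
theorem norm_trace_mul_le (X Y : Matrix n n ℂ) : ‖(X * Y).trace‖ ≤ Fintype.card n * (‖X‖ * ‖Y‖) :=
  calc ‖(X * Y).trace‖ = ‖∑ i, (X * Y) i i‖ := by rfl
    _ ≤ ∑ i, ‖(X * Y) i i‖ := norm_sum_le _ _
    _ ≤ ∑ _i : n, ‖X * Y‖ := Finset.sum_le_sum fun i _ => norm_entry_le (X * Y) i i
    _ = Fintype.card n * ‖X * Y‖ := by rw [Finset.sum_const, Finset.card_univ, nsmul_eq_mul]
    _ ≤ Fintype.card n * (‖X‖ * ‖Y‖) := by gcongr; exact norm_mul_le X Y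

/-- **THE MASTER BOUND, POINTWISE**: `‖X‖ ≤ B`, `‖Y‖ ≤ B′`, `‖S₁‖ ≤ S_st`, `‖S₂‖ ≤ S_s`, `‖S₃‖ ≤ S_t` ⟹
`|tr(X S₁) − tr(X S₂ Y S₃)| ≤ |n|·(B·S_st + B·S_s·B′·S_t)` (for the cell: `X = k₀(q)⁻¹`, `Y = k₀′(q)⁻¹`, `S₁, S₂, S₃ = k_st, k_s, k_t`). [folklore] -/
theorem norm_oneLoopForm_le_routeA {X Y S₁ S₂ S₃ : Matrix n n ℂ} {B B' Sst Ss St : ℝ} (hX : ‖X‖ ≤ B) (hY : ‖Y‖ ≤ B')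
    (h₁ : ‖S₁‖ ≤ Sst) (h₂ : ‖S₂‖ ≤ Ss) (h₃ : ‖S₃‖ ≤ St) :
    ‖(X * S₁).trace - (X * S₂ * Y * S₃).trace‖ ≤ Fintype.card n * (B * Sst + B * Ss * B' * St) := by
  have hB : 0 ≤ B := (norm_nonneg _).trans hX
  have hB' : 0 ≤ B' := (norm_nonneg _).trans hY
  have hSs : 0 ≤ Ss := (norm_nonneg _).trans h₂
  have t₁ : ‖(X * S₁).trace‖ ≤ Fintype.card n * (B * Sst) :=
    (norm_trace_mul_le X S₁).trans (mul_le_mul_of_nonneg_left (mul_le_mul hX h₁ (norm_nonneg _) hB) (Nat.cast_nonneg _))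
  have p₂ : ‖X * S₂ * Y‖ * ‖S₃‖ ≤ B * Ss * B' * St :=
    calc ‖X * S₂ * Y‖ * ‖S₃‖ ≤ ‖X * S₂‖ * ‖Y‖ * ‖S₃‖ := by gcongr; exact norm_mul_le _ _
      _ ≤ ‖X‖ * ‖S₂‖ * ‖Y‖ * ‖S₃‖ := by gcongr; exact norm_mul_le _ _
      _ ≤ B * Ss * B' * St := by
          refine mul_le_mul (mul_le_mul (mul_le_mul hX h₂ (norm_nonneg _) hB) hY (norm_nonneg _)
            (mul_nonneg hB hSs)) h₃ (norm_nonneg _) (mul_nonneg (mul_nonneg hB hSs) hB')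
  have t₂ : ‖(X * S₂ * Y * S₃).trace‖ ≤ Fintype.card n * (B * Ss * B' * St) :=
    (norm_trace_mul_le (X * S₂ * Y) S₃).trans (mul_le_mul_of_nonneg_left p₂ (Nat.cast_nonneg _))
  calc ‖(X * S₁).trace - (X * S₂ * Y * S₃).trace‖ ≤ ‖(X * S₁).trace‖ + ‖(X * S₂ * Y * S₃).trace‖ := norm_sub_le _ _
    _ ≤ Fintype.card n * (B * Sst) + Fintype.card n * (B * Ss * B' * St) := add_le_add t₁ t₂
    _ = Fintype.card n * (B * Sst + B * Ss * B' * St) := by ring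

end Norms

/-! ## §2 Character sums on the tube: the weighted stencil sum -/

section Stencils

variable {d : ℕ} {n : Type*} [Fintype n] [DecidableEq n]

/-- ON THE TUBE `|Im q_μ| ≤ w_μ` A LATTICE CHARACTER IS BOUNDED BY `e^{Σ_μ |x_μ| w_μ}`. [folklore] -/
theorem norm_character_le_of_mem_tube {w : Fin (d + 1) → ℝ} (x : Fin (d + 1) → ℤ) {p : Fin (d + 1) → ℂ} (hp : p ∈ Tube w) :
    ‖character x p‖ ≤ Real.exp (∑ μ, |(x μ : ℝ)| * w μ) := by
  unfold character
  rw [Complex.norm_exp, Complex.I_mul_re, Complex.im_sum]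
  refine Real.exp_le_exp.mpr ?_
  rw [← Finset.sum_neg_distrib]
  refine Finset.sum_le_sum fun μ _ => ?_
  have e : (((x μ : ℤ) : ℂ) * p μ).im = (x μ : ℝ) * (p μ).im := by
    rw [← Complex.ofReal_intCast, Complex.im_ofReal_mul]
  rw [e]
  calc -((x μ : ℝ) * (p μ).im) ≤ |(x μ : ℝ) * (p μ).im| := neg_le_abs _
    _ = |(x μ : ℝ)| * |(p μ).im| := abs_mul _ _
    _ ≤ |(x μ : ℝ)| * w μ := mul_le_mul_of_nonneg_left (hp μ) (abs_nonneg _)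

/-- **THE WEIGHTED STENCIL SUM BOUNDS A CHARACTER-SUM FAMILY ON THE TUBE**: for `k(q) = Σ_{x ∈ S} e^{i x·q} • K x` and `|Im q_μ| ≤ w_μ`,
`‖k(q)‖₂ ≤ Σ_{x ∈ S} e^{Σ_μ |x_μ| w_μ} · ‖K x‖₂` — CAP-KERNEL §4.10 (iii)'s `S_κ(a) = Σ_{ΔR} ‖K_κ[ΔR]‖₂ e^{a|ΔR|₁}` for equal half-widths; a
closed-form number once the stencil tables are typed (interface I-ζ5). [folklore] -/
theorem norm_characterSum_le_of_mem_tube {w : Fin (d + 1) → ℝ} (S : Finset (Fin (d + 1) → ℤ))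
    (K : (Fin (d + 1) → ℤ) → Matrix n n ℂ) {p : Fin (d + 1) → ℂ} (hp : p ∈ Tube w) :
    ‖∑ x ∈ S, character x p • K x‖ ≤ ∑ x ∈ S, Real.exp (∑ μ, |(x μ : ℝ)| * w μ) * ‖K x‖ := by
  refine (norm_sum_le _ _).trans (Finset.sum_le_sum fun x _ => ?_)
  rw [norm_smul]
  exact mul_le_mul_of_nonneg_right (norm_character_le_of_mem_tube x hp) (norm_nonneg _)

/-- the same read on the vertex tori of equal half-widths `κ` (where §3 wants it), with the `ℓ¹` weight `e^{κ|x|₁}`. [folklore] -/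
theorem norm_characterSum_le_of_mem_vertexTori {κ : ℝ} (S : Finset (Fin (d + 1) → ℤ))
    (K : (Fin (d + 1) → ℤ) → Matrix n n ℂ) {p : Fin (d + 1) → ℂ} (hp : p ∈ VertexTori (fun _ : Fin (d + 1) => κ)) :
    ‖∑ x ∈ S, character x p • K x‖ ≤ ∑ x ∈ S, Real.exp (κ * ∑ μ, |(x μ : ℝ)|) * ‖K x‖ := by
  have h := norm_characterSum_le_of_mem_tube S K
    (polyStrip_subset_tube _ (vertexTori_subset_polyStrip (fun _ : Fin (d + 1) => κ) hp))
  refine h.trans (le_of_eq (Finset.sum_congr rfl fun x _ => ?_))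
  rw [Finset.mul_sum]
  congr 2
  exact Finset.sum_congr rfl fun μ _ => mul_comm _ _

end Stencils

/-! ## §3 Route A's binder and rows -/

section Binder

variable {d : ℕ} {n : Type*} [Fintype n] [DecidableEq n]
variable {A A' B C D : (Fin (d + 1) → ℂ) → Matrix n n ℂ} {a κ Ba Ba' Sst Ss St : ℝ}

/-- **ROUTE A'S BINDER**: STRUCTURE `MatTubeHol` ×5 and (Z1) `det ≠ 0` on `Strip (d+1) a` ONCE at the zero-free half-width `a`; ON THE VERTEX TORI
`VertexTori κ` (`κ ≤ a`): (Z2a) resolvent-norm bounds `‖(A q)⁻¹‖₂ ≤ B`, `‖(A′ q)⁻¹‖₂ ≤ B′` (the located analytic lemma ∕ an «A1-explicit» face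
certificate, CAP-KERNEL §4.16) and (Z2b) stencil-norm bounds `‖B q‖₂ ≤ S_st`, `‖C q‖₂ ≤ S_s`, `‖D q‖₂ ≤ S_t` (§2: weighted stencil sums) ⟹
`StripRegularC (t₁ − t₂) κ (|n|·(B·S_st + B·S_s·B′·S_t))` — the (Z2) binder as route A's norm-chain number. [folklore] -/
theorem stripRegularC_oneLoopForm_routeA₂ (hκa : κ ≤ a) (hA : MatTubeHol A (fun _ => a)) (hA' : MatTubeHol A' (fun _ => a))
    (hBst : MatTubeHol B (fun _ => a)) (hBs : MatTubeHol C (fun _ => a)) (hBt : MatTubeHol D (fun _ => a))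
    (hdet : ∀ p ∈ Strip (d + 1) a, (A p).det ≠ 0) (hdet' : ∀ p ∈ Strip (d + 1) a, (A' p).det ≠ 0)
    (hBa : ∀ p ∈ VertexTori (fun _ : Fin (d + 1) => κ), ‖(A p)⁻¹‖ ≤ Ba)
    (hBa' : ∀ p ∈ VertexTori (fun _ : Fin (d + 1) => κ), ‖(A' p)⁻¹‖ ≤ Ba')
    (hSst : ∀ p ∈ VertexTori (fun _ : Fin (d + 1) => κ), ‖B p‖ ≤ Sst)
    (hSs : ∀ p ∈ VertexTori (fun _ : Fin (d + 1) => κ), ‖C p‖ ≤ Ss)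
    (hSt : ∀ p ∈ VertexTori (fun _ : Fin (d + 1) => κ), ‖D p‖ ≤ St) :
    StripRegularC (fun p => ((A p)⁻¹ * B p).trace - ((A p)⁻¹ * C p * (A' p)⁻¹ * D p).trace) κ
      (Fintype.card n * (Ba * Sst + Ba * Ss * Ba' * St)) :=
  stripRegularC_oneLoopForm₂_ofVertexTori hκa hA hA' hBst hBs hBt hdet hdet' fun p hp =>
    norm_oneLoopForm_le_routeA (hBa p hp) (hBa' p hp) (hSst p hp) (hSs p hp) (hSt p hp)

end Binder

section Rows

variable {b : ℕ → ℝ} {n : Type*} [Fintype n] [DecidableEq n]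
variable {A A' B C D : (Fin 4 → ℂ) → Matrix n n ℂ} {a κ Ba Ba' Sst Ss St : ℝ}

/-- **THE ONE-LOOP-FORM ANCHOR ON ROUTE A** (code16, engine convention; two widths).  Binders by kind: (N) `hb` the level-0 DICTIONARY (row D1);
STRUCTURE `hA…hBt : MatTubeHol _ (fun _ => a)`; (Z1) `hdet hdet'` on `Strip 4 a`; **(Z2a) `hBa hBa'` resolvent-norm bounds and (Z2b) `hSst hSs hSt`
stencil-norm bounds ON THE 16 VERTEX TORI `VertexTori κ`** (`0 < κ ≤ a`); (T) `hT` the two-engine ball for the mean over `code16SetE N`; (A) `hA₀` with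
`M := |n|·(B·S_st + B·S_s·B′·S_t)` (kernel: `CapLatticeBudget.budget_code16_param`); cmp `hlo` ⟹ `Rows b`, `k₀ = 0`, `lo 0 = lo`. [folklore] -/
def rowsOfOneLoopFormCode16E_routeA₂
    (hb : b 0 = (latticeKernel (fun p => ((A p)⁻¹ * B p).trace - ((A p)⁻¹ * C p * (A' p)⁻¹ * D p).trace) 0).re)
    (hκ : 0 < κ) (hκa : κ ≤ a) (hA : MatTubeHol A (fun _ => a)) (hA' : MatTubeHol A' (fun _ => a))
    (hBst : MatTubeHol B (fun _ => a)) (hBs : MatTubeHol C (fun _ => a)) (hBt : MatTubeHol D (fun _ => a))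
    (hdet : ∀ p ∈ Strip (3 + 1) a, (A p).det ≠ 0) (hdet' : ∀ p ∈ Strip (3 + 1) a, (A' p).det ≠ 0)
    (hBa : ∀ p ∈ VertexTori (fun _ : Fin (3 + 1) => κ), ‖(A p)⁻¹‖ ≤ Ba)
    (hBa' : ∀ p ∈ VertexTori (fun _ : Fin (3 + 1) => κ), ‖(A' p)⁻¹‖ ≤ Ba')
    (hSst : ∀ p ∈ VertexTori (fun _ : Fin (3 + 1) => κ), ‖B p‖ ≤ Sst)
    (hSs : ∀ p ∈ VertexTori (fun _ : Fin (3 + 1) => κ), ‖C p‖ ≤ Ss)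
    (hSt : ∀ p ∈ VertexTori (fun _ : Fin (3 + 1) => κ), ‖D p‖ ≤ St)
    {N : ℕ} (hN : 1 ≤ N) [NeZero (4 * N)] {t r : ℝ}
    (hT : ‖((code16SetE N).card : ℂ)⁻¹ *
        (∑ w ∈ code16SetE N, descend (fun p => ((A p)⁻¹ * B p).trace - ((A p)⁻¹ * C p * (A' p)⁻¹ * D p).trace)
          (gridPt (4 * N) w)) - t‖ ≤ r)
    {A₀ : ℝ} (hA₀ : Fintype.card n * (Ba * Sst + Ba * Ss * Ba' * St) * codeTheta (aliasRatioL1 κ N) ≤ A₀) (lo : ℚ)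
    (hlo : ((lo : ℚ) : ℝ) ≤ t - r - A₀) : Rows b :=
  rowsOfCode16E hb (stripRegularC_oneLoopForm_routeA₂ hκa hA hA' hBst hBs hBt hdet hdet' hBa hBa' hSst hSs hSt) hκ hN hT hA₀ lo hlo

variable {β : HBeta}

/-- **THE CERTIFIED ROAD ON ROUTE A** — row CAP-k's typed target with the (Z2) certificate REPLACED by two resolvent-norm numbers and three stencil
numbers on the vertex tori: the binders of `rowsOfOneLoopFormCode16E_routeA₂` (`b := S.β0`) + `GeomRate S.β0 binf c₀ θ` (`0 ≤ θ ≤ 1`) + `hk₂` at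
`k₀ = 0` + `RemainderConst S γ₀ r′` ⟹ `BetaAvgAFH (min lo (3(lo − c₀)/4) − r′) 0 γ₀ β`.  0 of these binders is instantiated in the tree. [folklore] -/
theorem betaAvgAFH_of_oneLoopFormCode16E_routeA₂ (S : B12Beta.OneLoopSplit β)
    (hb : S.β0 0 = (latticeKernel (fun p => ((A p)⁻¹ * B p).trace - ((A p)⁻¹ * C p * (A' p)⁻¹ * D p).trace) 0).re)
    (hκ : 0 < κ) (hκa : κ ≤ a) (hA : MatTubeHol A (fun _ => a)) (hA' : MatTubeHol A' (fun _ => a))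
    (hBst : MatTubeHol B (fun _ => a)) (hBs : MatTubeHol C (fun _ => a)) (hBt : MatTubeHol D (fun _ => a))
    (hdet : ∀ p ∈ Strip (3 + 1) a, (A p).det ≠ 0) (hdet' : ∀ p ∈ Strip (3 + 1) a, (A' p).det ≠ 0)
    (hBa : ∀ p ∈ VertexTori (fun _ : Fin (3 + 1) => κ), ‖(A p)⁻¹‖ ≤ Ba)
    (hBa' : ∀ p ∈ VertexTori (fun _ : Fin (3 + 1) => κ), ‖(A' p)⁻¹‖ ≤ Ba')
    (hSst : ∀ p ∈ VertexTori (fun _ : Fin (3 + 1) => κ), ‖B p‖ ≤ Sst)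
    (hSs : ∀ p ∈ VertexTori (fun _ : Fin (3 + 1) => κ), ‖C p‖ ≤ Ss)
    (hSt : ∀ p ∈ VertexTori (fun _ : Fin (3 + 1) => κ), ‖D p‖ ≤ St)
    {N : ℕ} (hN : 1 ≤ N) [NeZero (4 * N)] {t rT : ℝ}
    (hT : ‖((code16SetE N).card : ℂ)⁻¹ *
        (∑ w ∈ code16SetE N, descend (fun p => ((A p)⁻¹ * B p).trace - ((A p)⁻¹ * C p * (A' p)⁻¹ * D p).trace)
          (gridPt (4 * N) w)) - t‖ ≤ rT)
    {A₀ : ℝ} (hA₀ : Fintype.card n * (Ba * Sst + Ba * Ss * Ba' * St) * codeTheta (aliasRatioL1 κ N) ≤ A₀) (lo : ℚ)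
    (hlo : ((lo : ℚ) : ℝ) ≤ t - rT - A₀)
    {γ₀ binf c₀ θ r : ℝ} (hθ0 : 0 ≤ θ) (hθ1 : θ ≤ 1) (hconv : GeomRate S.β0 binf c₀ θ)
    (hk₂ : c₀ * θ ^ (0 + 1) ≤ ((lo : ℝ) - c₀ * θ ^ 0) / 4) (hrem : RemainderConst S γ₀ r) :
    BetaAvgAFH (min ((lo : ℚ) : ℝ) (3 * ((lo : ℝ) - c₀ * θ ^ 0) / 4) - r) 0 γ₀ β :=
  betaAvgAFH_of_anchorCode16E S hb (stripRegularC_oneLoopForm_routeA₂ hκa hA hA' hBst hBs hBt hdet hdet' hBa hBa' hSst hSs hSt) hκ hN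
    hT hA₀ lo hlo hθ0 hθ1 hconv hk₂ hrem

end Rows

/-! ## §4 THEOREM MP for matrix families: the operator norm on the tube is bounded by its maximum on the vertex tori -/

section MatrixMP

variable {d : ℕ} {n : Type*} [Fintype n] [DecidableEq n]
variable {A : (Fin (d + 1) → ℂ) → Matrix n n ℂ} {w : Fin (d + 1) → ℝ} {M : ℝ}

omit [DecidableEq n] in
/-- the sesquilinear matrix element `q ↦ xᴴ A(q) y` of a tube-holomorphic matrix family is tube-holomorphic. [folklore] -/
theorem tubeHol_pairing (hA : MatTubeHol A w) (x y : n → ℂ) :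
    TubeHol (fun q => star x ⬝ᵥ (A q *ᵥ y)) w := by
  have e : (fun q => star x ⬝ᵥ (A q *ᵥ y)) = fun q => ∑ i, ∑ j, (star (x i) * y j) * A q i j := by
    funext q
    simp only [dotProduct, mulVec, Pi.star_apply, Finset.mul_sum]
    exact Finset.sum_congr rfl fun i _ => Finset.sum_congr rfl fun j _ => by ring
  rw [e]
  exact TubeHol.sum _ fun i _ => TubeHol.sum _ fun j _ => (hA i j).const_mul _

/-- the vertex tori of a tube containing a point are nonempty: the point `(w_μ·i)_μ`. [folklore] -/
theorem vertexTori_nonempty_of_mem_tube {p : Fin (d + 1) → ℂ} (hp : p ∈ Tube w) :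
    (fun μ => ((w μ : ℝ) : ℂ) * I) ∈ VertexTori w := by
  intro μ
  have hw : 0 ≤ w μ := (abs_nonneg _).trans (hp μ)
  refine ⟨?_, ?_⟩
  · simp [Real.pi_pos.le]
  · simp [abs_of_nonneg hw]

/-- **THEOREM MP FOR MATRIX FAMILIES** (CAP-KERNEL §4.10 (i)): a tube-holomorphic matrix family with `‖A(q)‖₂ ≤ M` on the VERTEX TORI has
`‖A(q)‖₂ ≤ M` on the whole closed tube — `sup_{tube} ‖A‖₂ = max_{vertex tori} ‖A‖₂`; for the cell: a face certificate of `‖k₀(q)⁻¹‖₂` IS the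
strip constant `B_a`. [folklore] -/
theorem matTubeHol_opNorm_le_of_vertexTori (hA : MatTubeHol A w) (hM : ∀ q ∈ VertexTori w, ‖A q‖ ≤ M) :
    ∀ q ∈ Tube w, ‖A q‖ ≤ M := by
  intro q hq
  have hM0 : 0 ≤ M := (norm_nonneg _).trans (hM _ (vertexTori_nonempty_of_mem_tube hq))
  rw [Matrix.l2_opNorm_def]
  refine ContinuousLinearMap.opNorm_le_bound _ hM0 fun y => ?_
  change ‖(toLp 2 (A q *ᵥ ofLp y) : EuclideanSpace ℂ n)‖ ≤ M * ‖y‖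
  set x : EuclideanSpace ℂ n := toLp 2 (A q *ᵥ ofLp y) with hxdef
  -- the matrix element `q' ↦ xᴴ A(q') y` is bounded by `‖x‖·M·‖y‖` on the vertex tori, hence on the tube
  have hface : ∀ q' ∈ VertexTori w, ‖star (ofLp x) ⬝ᵥ (A q' *ᵥ ofLp y)‖ ≤ ‖x‖ * (M * ‖y‖) := fun q' hq' =>
    (norm_dotProduct_mulVec_le (A q') x y).trans (by gcongr; exact hM q' hq')
  have htube : ‖star (ofLp x) ⬝ᵥ (A q *ᵥ ofLp y)‖ ≤ ‖x‖ * (M * ‖y‖) :=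
    (tubeHol_pairing hA (ofLp x) (ofLp y)).norm_le_of_vertexTori hface q hq
  have hsq : ‖star (ofLp x) ⬝ᵥ (A q *ᵥ ofLp y)‖ = ‖x‖ ^ 2 := by
    rw [star_dotProduct_mulVec_eq_inner, ← hxdef, inner_self_eq_norm_sq_to_K, norm_pow, RCLike.norm_ofReal,
      abs_norm]
  rw [hsq, sq] at htube
  by_cases hx0 : ‖x‖ = 0
  · rw [hx0]; positivity
  · exact le_of_mul_le_mul_left htube (lt_of_le_of_ne (norm_nonneg _) (Ne.symm hx0))

end MatrixMP


/-! ## §5 (v1.1, APPEND-ONLY) Route A via the CAPACITANCE SPLIT — census V17 made kernel by cap3-g10's `CapacitanceSplit` (p-id in the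
journal; courier lit1-g29): `k₀ = k_off + U·N·V`, `k₀⁻¹ = 𝒜 − 𝒜U(N𝒦̃⁻¹)V𝒜` (push-through Woodbury with a SINGULAR middle factor),
`‖k₀⁻¹‖ ≤ ‖𝒜‖(1 + ‖U‖‖N𝒦̃⁻¹‖‖V‖‖𝒜‖)` (`CapacitanceSplit.norm_inv_add_le`).  Read on the vertex tori this IS the binder `hBa` of
`rowsOfOneLoopFormCode16E_routeA₂` with `B := α(1 + u·x·v·α)` from four face numbers: `α ≥ ‖𝒜(q)‖ = ‖k_off(q)⁻¹‖` (the «A1-explicit»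
certificate object, CAP-KERNEL §4.16 ∕ §4.19), `u ≥ ‖U(q)‖`, `v ≥ ‖V(q)‖` (closed form), `x ≥ ‖N(q)·𝒦̃(q)⁻¹‖` (the det𝒦₄-margin object). -/

section Split

open Summit.QuantumFields.BalabanUV.Beta.CapacitanceSplit (capMat norm_inv_add_le)

variable {d : ℕ} {n m : Type*} [Fintype n] [Fintype m] [DecidableEq n] [DecidableEq m]
variable {A Koff 𝒜 : (Fin (d + 1) → ℂ) → Matrix n n ℂ} {U : (Fin (d + 1) → ℂ) → Matrix n m ℂ}
  {Nm Ki : (Fin (d + 1) → ℂ) → Matrix m m ℂ} {V : (Fin (d + 1) → ℂ) → Matrix m n ℂ} {κ α u x v : ℝ}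

/-- **THE RESOLVENT BOUND ON THE VERTEX TORI FROM THE CAPACITANCE SPLIT**: on `VertexTori κ` let `A q = Koff q + U q · Nm q · V q`
(the split, an identity of typed tables), `Koff q · 𝒜 q = 1` (𝒜 = the deflated inverse), `capMat (V q) (𝒜 q) (U q) (Nm q) · Ki q = 1`
(𝒦̃⁻¹), and face bounds `‖𝒜 q‖ ≤ α`, `‖U q‖ ≤ u`, `‖Nm q · Ki q‖ ≤ x`, `‖V q‖ ≤ v` ⟹ `‖(A q)⁻¹‖ ≤ α·(1 + u·x·v·α)` there — the `hBa`
binder of `rowsOfOneLoopFormCode16E_routeA₂` ∕ `stripRegularC_oneLoopForm_routeA₂`. [folklore] -/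
theorem norm_inv_le_of_split_vertexTori
    (hsplit : ∀ q ∈ VertexTori (fun _ : Fin (d + 1) => κ), A q = Koff q + U q * Nm q * V q)
    (hinv : ∀ q ∈ VertexTori (fun _ : Fin (d + 1) => κ), Koff q * 𝒜 q = 1)
    (hcap : ∀ q ∈ VertexTori (fun _ : Fin (d + 1) => κ), capMat (V q) (𝒜 q) (U q) (Nm q) * Ki q = 1)
    (hα : ∀ q ∈ VertexTori (fun _ : Fin (d + 1) => κ), ‖𝒜 q‖ ≤ α)
    (hu : ∀ q ∈ VertexTori (fun _ : Fin (d + 1) => κ), ‖U q‖ ≤ u)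
    (hx : ∀ q ∈ VertexTori (fun _ : Fin (d + 1) => κ), ‖Nm q * Ki q‖ ≤ x)
    (hv : ∀ q ∈ VertexTori (fun _ : Fin (d + 1) => κ), ‖V q‖ ≤ v) :
    ∀ q ∈ VertexTori (fun _ : Fin (d + 1) => κ), ‖(A q)⁻¹‖ ≤ α * (1 + u * x * v * α) := by
  intro q hq
  have hα0 : 0 ≤ α := (norm_nonneg _).trans (hα q hq)
  have hu0 : 0 ≤ u := (norm_nonneg _).trans (hu q hq)
  have hx0 : 0 ≤ x := (norm_nonneg _).trans (hx q hq)
  have h4 : ‖U q‖ * ‖Nm q * Ki q‖ * ‖V q‖ * ‖𝒜 q‖ ≤ u * x * v * α :=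
    mul_le_mul (mul_le_mul (mul_le_mul (hu q hq) (hx q hq) (norm_nonneg _) hu0) (hv q hq) (norm_nonneg _)
      (mul_nonneg hu0 hx0)) (hα q hq) (norm_nonneg _) (mul_nonneg (mul_nonneg hu0 hx0) ((norm_nonneg _).trans (hv q hq)))
  rw [hsplit q hq]
  calc ‖(Koff q + U q * Nm q * V q)⁻¹‖ ≤ ‖𝒜 q‖ * (1 + ‖U q‖ * ‖Nm q * Ki q‖ * ‖V q‖ * ‖𝒜 q‖) :=
        norm_inv_add_le (hinv q hq) (hcap q hq)
    _ ≤ α * (1 + u * x * v * α) :=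
        mul_le_mul (hα q hq) (by linarith) (by positivity) hα0

/-- the (Z1)-side of the split on the period cell: `det (A q) ≠ 0` from `Koff q · 𝒜 q = 1` and the invertibility of the capacitance
matrix (`CapacitanceSplit.isUnit_det_add_of_capMat`) — the `hdet` binder, given the split data on `Strip (d+1) a`. [folklore] -/
theorem det_ne_zero_of_split {a : ℝ}
    (hsplit : ∀ q ∈ Strip (d + 1) a, A q = Koff q + U q * Nm q * V q)
    (hinv : ∀ q ∈ Strip (d + 1) a, Koff q * 𝒜 q = 1)
    (hcap : ∀ q ∈ Strip (d + 1) a, capMat (V q) (𝒜 q) (U q) (Nm q) * Ki q = 1) :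
    ∀ q ∈ Strip (d + 1) a, (A q).det ≠ 0 := by
  intro q hq
  rw [hsplit q hq]
  exact (CapacitanceSplit.isUnit_det_add_of_capMat (hinv q hq) (hcap q hq)).ne_zero

end Split

end

end Summit.QuantumFields.BalabanUV.Beta.CapRouteA
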